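import Literature.NumberTheory.EllipticCurves.CanonicalPAdicHeightSqThetaProofs
import Literature.NumberTheory.EllipticCurves.CanonicalPAdicHeightSigmaThetaProofs
import Literature.NumberTheory.EllipticCurves.CanonicalPAdicHeightAdmissibilityCriteria
import Literature.NumberTheory.EllipticCurves.CanonicalPAdicHeightLocusProofs
import Literature.NumberTheory.EllipticCurves.PadicSeriesIdentityProofs
import HarnessLib

/-!
# The canonical `p`-adic height, sigma-SQUARED form: quadraticity and existence of the canonical
# datum at EVERY good ordinary prime admitting a sigma-squared pair — including `p = 2`
# (proofs only)

Trunk T-NT-EC (`Literature/NumberTheory/EllipticCurves`). Pure proof file (no definitions, no named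
facts), sequel of `CanonicalPAdicHeightSqThetaProofs.lean` (the squared theta relation
`Σ_p(z(P+Q))·Σ_p(z(P−Q)) = (x(Q) − x(P))²·Σ_p(z(P))²·Σ_p(z(Q))²` at rational points of the kernel of
reduction, `padicSigmaSqEval_theta_of_exists`) and Σ-twin of `CanonicalPAdicHeightSigmaThetaProofs.lean`
(which does the same for `σ_p` and `canonicalPAdicHeight`, `p` odd).

Recall (`PadicSigmaSq.lean`) the sigma-squared form of the Stein–Wuthrich height
`canonicalPAdicHeightSq W p P = log_p den x(P) − log_p Σ_p(z(P))`, `Σ_p = padicSigmaSq (W ⊗ ℚ_p)`, and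
the predicate `PAdicHeightData.IsCanonicalSq D : ∀ P admissible, ⟨P, P⟩_D = canonicalPAdicHeightSq P` —
the receptacle for "THE canonical cyclotomic `p`-adic height" at a good ordinary `p = 2`, where the
Mazur–Tate sigma function exists only through its square (Silverman 2005 §5 Rem. 2; Mazur–Tate 1991
Thm. 3.1) and `PAdicHeightData.IsCanonical` is unsatisfiable (`CanonicalPAdicHeightTwoJunkProofs.lean`).
Until now nothing in the tree produced a datum `D` with `D.IsCanonicalSq` at `p = 2`, so every
statement `∀ D, D.IsCanonicalSq → …` at `2` was vacuous. This file closes that gap: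

* `padicSigmaSq_normalised`, `norm_padicSigmaSqEval_sub_lt`, `padicSigmaSqEval_ne_zero`,
  `padicSigmaSqEval_param_ne_zero` — in every branch of its definition `Σ_p ∈ t² + t³ℤ_p⟦t⟧`, hence
  `‖Σ_p(t) − t²‖ < ‖t‖²` and `Σ_p(t) ≠ 0` for `0 < ‖t‖ < 1`, in particular at `t = z(P)`,
  `P ∈ E(ℚ) ∩ E₁(ℚ_p)`;
* `canonicalPAdicHeightSq_parallelogram_of_exists` — **the sigma-squared formula is a quadratic
  function**: for `W/ℚ` elliptic with `ℤ`-integral equation, ANY prime `p` at which `W ⊗ ℚ_p` carries a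
  sigma-squared pair, and `P, Q ∈ E(ℚ)` satisfying the local conditions with `P ≠ ±Q`,
  `ĥ^Σ(P+Q) + ĥ^Σ(P−Q) = 2ĥ^Σ(P) + 2ĥ^Σ(Q)` — from the squared theta relation, Néron's denominator law
  `den x(P+Q)·den x(P−Q) = den x(P)²·den x(Q)²·(x(P) − x(Q))²` (`den_mul_den_eq`, prime-free) and
  `log_p(ab) = log_p a + log_p b`; the printed argument of Mazur–Stein–Tate 2006 §2.6–2.7 ("`h_p` is
  quadratic because of property IV of `σ`"), run on `Σ = σ²` so that no square root is ever taken;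
* `not_isOfFinAddOrder_of_inSigmaDisc` — **the local-conditions locus is torsion-free at every prime**:
  a rational point `(x, y)` with `‖x‖_p > 1` and `z = −x/y` in the sigma disc is non-torsion. For `p ≥ 3`
  this is the tree's `not_isOfFinAddOrder_of_one_lt_norm` (AEC VII.3.4); at `p = 2` the disc condition
  `‖z‖₂ < ½` puts the point in `Ê(4ℤ₂)`, where a multiple of prime order `q` is impossible: for odd `q`
  by `val_le_one_of_zsmul_eq_zero` (`ΨSq_q` has unit leading coefficient), for `q = 2` because
  `ψ₂² = 4x³ + b₂x² + 2b₄x + b₆` cannot vanish when `‖x‖₂ > 4` (the term `4x³` dominates) — AEC IV.6.1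
  with `r = v(z) ≥ 2 > v(2)/(2 − 1)`;
* `exists_isCanonicalSq_of_exists`, `PAdicHeightData.isCanonicalSq_unique`,
  `existsUnique_isCanonicalSq_of_exists` — hence **a (unique) datum `D : PAdicHeightData W p` with
  `D.IsCanonicalSq` exists for every `ℤ`-integral (resp. globally minimal) elliptic `W/ℚ` and every
  prime `p` at which a sigma-squared pair exists** (Jordan–von Neumann on the finite-index torsion-free
  locus, `parallelogram_of_generic` + `exists_pairing_of_parallelogram`; uniqueness from admissible
  multiples `exists_admissible_nsmul_holds`);
* `exists_isCanonicalSq_two`, `existsUnique_isCanonicalSq_two` — **at `p = 2`**: for `W/ℚ` globally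
  minimal with good ORDINARY reduction at `2`, under the printed fact
  `mazurTate_sigmaSq_existsUnique_two` (Silverman 2005 §5 Rem. 2 ⟹ the squared pair exists,
  `exists_isMazurTateSigmaSqPair_two`), THE canonical `2`-adic height datum in sigma-squared form exists
  and is unique. This makes the `p = 2` hypotheses typed over `IsCanonicalSq` (Bertrand's
  non-degeneracy at `2`, Li–Tian–Yuan–Zhang (7.7) at `2`, …) statements about an object that exists;
* `exists_isCanonicalSq_of_exists_pair` — at a prime with a genuine Mazur–Tate pair `(σ, c)` (every odd
  good ordinary `p`) the same datum exists in the squared vocabulary (and is the `IsCanonical` datum by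
  `isCanonicalSq_iff_isCanonical_of_exists`).

Nothing is asserted: no `sorry`, no new definition, no new named fact; the only printed input at
`p = 2` is the hypothesis `mazurTate_sigmaSq_existsUnique_two` carried explicitly.

## Sources

* B. Mazur, J. Tate, *The `p`-adic sigma function*, Duke Math. J. 62 (1991): Thm. 3.1 (for `p = 2`
  only `σ²` is defined over `ℤ_p`; properties III–IV).
* B. Mazur, W. Stein, J. Tate, *Computation of `p`-adic heights and log convergence*, Doc. Math. Extra
  Vol. Coates (2006): §1 eq. (1.1) ("extends uniquely to a function on `E(ℚ)` with
  `h_p(nQ) = n²h_p(Q)`"), §2.6–2.7 ("`h_ρ` is quadratic because of property IV of `σ`").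
* W. Stein, C. Wuthrich, *Algorithms for the arithmetic of elliptic curves using Iwasawa theory*,
  Math. Comp. 82 (2013): §4.1 eq. (4.1) (`ĥ_p(P) = 2 log_p(e(P)/σ_p(z(P)))`), §4 (range of convergence).
* J. H. Silverman, *`p`-adic properties of division polynomials and elliptic divisibility sequences*,
  Math. Ann. 332 (2005): §5 Rem. 2 (`σ²` at `p = 2`).
* J. H. Silverman, *The Arithmetic of Elliptic Curves*, 2nd ed. (2009): IV.3.2, IV.6.1, VII.2.1–2.2,
  VII.3.4, Exercise 3.7.
-/

noncomputable section

open scoped Classical NNReal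
open Literature.NumberTheory.EllipticCurves

namespace WeierstrassCurve

/-! ### The sigma-squared series is normalised and non-vanishing on the punctured unit disc -/

section Series

open PowerSeries

variable {p : ℕ} [Fact p.Prime] (V : WeierstrassCurve ℚ_[p])

/-- **`Σ_p ∈ t² + t³ℤ_p⟦t⟧` in every branch of its definition**: `Σ_p` has coefficients in `ℤ_p`,
`Σ_p(0) = 0`, `[t]Σ_p = 0`, `[t²]Σ_p = 1` — whether `Σ_p = σ_p²` (a Mazur–Tate pair exists), `Σ_p` is a
chosen sigma-squared pair, or `Σ_p = t²` (junk). [Silverman 2005, §5 Rem. 2 ("`σ²` is defined over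
`ℤ_p`"); Mazur–Stein–Tate 2006, Thm. 1.3] [cite: Silverman2005DivPoly, §5 Rem. 2] -/
theorem padicSigmaSq_normalised :
    IsPadicInt V.padicSigmaSq ∧ constantCoeff V.padicSigmaSq = 0 ∧ coeff 1 V.padicSigmaSq = 0 ∧
      coeff 2 V.padicSigmaSq = 1 := by
  by_cases h : (∃ σ : ℚ_[p]⟦X⟧, ∃ c : ℚ_[p], V.IsMazurTateSigmaPair σ c) ∨
      ∃ Sq : ℚ_[p]⟦X⟧, ∃ c : ℚ_[p], V.IsMazurTateSigmaSqPair Sq c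
  · have hpair := isMazurTateSigmaSqPair_padicSigmaSq h
    exact ⟨hpair.isPadicInt, hpair.constantCoeff_eq, hpair.coeff_one_eq, hpair.coeff_two_eq⟩
  · rw [not_or] at h
    rw [padicSigmaSq_eq_X_sq_of_not_exists h.1 h.2]
    exact ⟨IsPadicInt.powerSeries_X.pow 2, by simp, by simp [coeff_X_pow], by simp [coeff_X_pow]⟩

variable (W : WeierstrassCurve ℚ) (p)

/-- **`‖Σ_p(t) − t²‖ < ‖t‖²` for `0 < ‖t‖ < 1`**: `Σ_p = t²·G` with `G ∈ 1 + tℤ_p⟦t⟧`, so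
`Σ_p(t) = t²G(t)` with `‖G(t) − 1‖ ≤ ‖t‖ < 1`. (Σ-twin of `norm_padicSigmaEval_sub_lt`.)
[Mazur–Stein–Tate 2006, Thm. 1.3 (`σ(t) = t + ⋯ ∈ tℤ_p⟦t⟧`); Silverman 2005, §5 Rem. 2]
[cite: Silverman2005DivPoly, §5 Rem. 2] -/
theorem norm_padicSigmaSqEval_sub_lt {t : ℚ_[p]} (ht0 : t ≠ 0) (ht : ‖t‖ < 1) :
    ‖W.padicSigmaSqEval p t - t ^ 2‖ < ‖t‖ ^ 2 := by
  obtain ⟨hint, h0, h1, h2⟩ := (W.baseChange ℚ_[p]).padicSigmaSq_normalised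
  set G : ℚ_[p]⟦X⟧ := PowerSeries.mk fun n => coeff (n + 2) (W.baseChange ℚ_[p]).padicSigmaSq
    with hGdef
  have hG : IsPadicInt G := isPadicInt_shift hint 2
  have hSG : (W.baseChange ℚ_[p]).padicSigmaSq = X ^ 2 * G := by
    ext n
    rw [coeff_X_pow_mul']
    split_ifs with hn
    · rw [hGdef, coeff_mk, Nat.sub_add_cancel hn]
    · interval_cases n
      · rw [coeff_zero_eq_constantCoeff_apply]; exact h0
      · exact h1
  have hG0 : constantCoeff G = 1 := by
    rw [← coeff_zero_eq_constantCoeff_apply, hGdef, coeff_mk, zero_add]; exact h2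
  have hGt : ‖padicEval G t - 1‖ < 1 := by
    have := norm_padicEval_sub_constantCoeff_le hG ht
    rw [hG0] at this
    exact this.trans_lt ht
  have hX : IsPadicInt (X : ℚ_[p]⟦X⟧) := IsPadicInt.powerSeries_X
  have heval : W.padicSigmaSqEval p t = t ^ 2 * padicEval G t := by
    unfold padicSigmaSqEval
    rw [hSG, padicEval_mul (hX.pow 2) hG ht, padicEval_pow hX ht 2, padicEval_X]
  rw [heval, ← mul_sub_one, norm_mul, norm_pow]
  exact mul_lt_of_lt_one_right (pow_pos (norm_pos_iff.mpr ht0) 2) hGt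

/-- **`Σ_p(t) ≠ 0` for `0 < ‖t‖ < 1`** (`‖Σ_p(t)‖ = ‖t‖²`). [Mazur–Stein–Tate 2006, §2.3 ("`σ_v` as a
mapping from `E₁(K_v)` to `K_v^*`"); Silverman 2005, §5 Rem. 2] [cite: Silverman2005DivPoly, §5 Rem. 2] -/
theorem padicSigmaSqEval_ne_zero {t : ℚ_[p]} (ht0 : t ≠ 0) (ht : ‖t‖ < 1) :
    W.padicSigmaSqEval p t ≠ 0 := by
  intro h0
  have := W.norm_padicSigmaSqEval_sub_lt p ht0 ht
  rw [h0, zero_sub, norm_neg, norm_pow] at this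
  exact lt_irrefl _ this

/-- **`Σ_p(z(P)) ≠ 0` for `P = (x, y) ∈ E(ℚ) ∩ E₁(ℚ_p)`** (`ℤ`-integral equation, any prime `p`):
`z(P) = −x/y` lies in the punctured open unit disc (`param_facts`). [Mazur–Stein–Tate 2006, §2.3]
[cite: MazurSteinTate2006, §2.3] -/
theorem padicSigmaSqEval_param_ne_zero [W.IsIntegral ℤ] {x y : ℚ} (h : W.toAffine.Nonsingular x y)
    (hx : 1 < ‖(x : ℚ_[p])‖) : W.padicSigmaSqEval p (-(x : ℚ_[p]) / y) ≠ 0 := by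
  obtain ⟨-, hz0, hz1, -, -⟩ :=
    (W.baseChange ℚ_[p]).param_facts (nonsingular_ratCast (p := p) h).1 hx
  exact W.padicSigmaSqEval_ne_zero p hz0 hz1

end Series

/-! ### The parallelogram law of the sigma-squared formula on generic admissible pairs -/

section Parallelogram

variable {W : WeierstrassCurve ℚ} [W.IsElliptic] [W.IsIntegral ℤ] {p : ℕ} [Fact p.Prime]

/-- **The sigma-squared formula is a quadratic function: parallelogram law on generic admissible
pairs, at every prime with a sigma-squared pair.** For `W/ℚ` elliptic with `ℤ`-integral equation, a
prime `p` at which `W ⊗ ℚ_p` carries a sigma-squared pair `(Σ, c)` (so that `Σ_p = padicSigmaSq` is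
one), and `P, Q ∈ E(ℚ)` both satisfying the local conditions (in `E₁(ℚ_p)`, in the sigma disc,
non-singular reduction everywhere) with `P ≠ ±Q`:
`ĥ^Σ_p(P + Q) + ĥ^Σ_p(P − Q) = 2ĥ^Σ_p(P) + 2ĥ^Σ_p(Q)`, `ĥ^Σ_p = canonicalPAdicHeightSq`
(`= log_p den x − log_p Σ_p(z)`). Computation: `d₃d₄ = d₁²d₂²δ²` (Néron's denominator law at every `ℓ`,
`den_mul_den_eq` + `padicValNat_den_parallelogram_holds`), `Σ₃Σ₄ = δ²Σ₁²Σ₂²` (the squared theta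
relation `padicSigmaSqEval_theta_of_exists`), `log_p(ab) = log_p a + log_p b`, `log_p(−δ) = log_p δ`.
This is Mazur–Stein–Tate's "`h_ρ` is quadratic because of property IV of `σ`", run on `Σ = σ²`; valid
verbatim at `p = 2`. [Mazur–Stein–Tate 2006, §2.6–2.7; Stein–Wuthrich 2013, §4.1 eq. (4.1); Mazur–Tate
1991, Thm. 3.1] [cite: MazurSteinTate2006, §2.7] -/
theorem canonicalPAdicHeightSq_parallelogram_of_exists
    (hex : ∃ Sq : PowerSeries ℚ_[p], ∃ c : ℚ_[p], (W.baseChange ℚ_[p]).IsMazurTateSigmaSqPair Sq c)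
    (P Q : W.toAffine.Point) (hP : W.SatisfiesLocalConditions p P)
    (hQ : W.SatisfiesLocalConditions p Q) (hsub : P - Q ≠ 0) (hadd : P + Q ≠ 0) :
    W.canonicalPAdicHeightSq p (P + Q) + W.canonicalPAdicHeightSq p (P - Q) =
      2 * W.canonicalPAdicHeightSq p P + 2 * W.canonicalPAdicHeightSq p Q := by
  have hmul : padicLog_mul p := padicLog_mul_holds p
  have hden : padicValNat_den_parallelogram := padicValNat_den_parallelogram_holds
  -- the subgroup: `P ± Q` again satisfy the local conditions
  obtain ⟨H, hH⟩ := W.exists_addSubgroup_coe_eq_localConditionsLocus_of_isIntegral p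
  have hmem : ∀ R, R ∈ H ↔ R = 0 ∨ W.SatisfiesLocalConditions p R := fun R => by
    rw [← SetLike.mem_coe, hH]; rfl
  have hPH : P ∈ H := (hmem P).mpr (Or.inr hP)
  have hQH : Q ∈ H := (hmem Q).mpr (Or.inr hQ)
  have hS' : W.SatisfiesLocalConditions p (P + Q) :=
    ((hmem _).mp (H.add_mem hPH hQH)).resolve_left hadd
  have hD' : W.SatisfiesLocalConditions p (P - Q) :=
    ((hmem _).mp (H.sub_mem hPH hQH)).resolve_left hsub
  -- coordinates of the four points
  rcases P with _ | ⟨x₁, y₁, h₁⟩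
  · exact (W.not_satisfiesLocalConditions_zero p hP).elim
  rcases Q with _ | ⟨x₂, y₂, h₂⟩
  · exact (W.not_satisfiesLocalConditions_zero p hQ).elim
  have hx : x₁ ≠ x₂ := X_ne_of_sub_ne_zero_of_add_ne_zero h₁ h₂ hsub hadd
  rcases hS : (.some x₁ y₁ h₁ : W.toAffine.Point) + .some x₂ y₂ h₂ with _ | ⟨x₃, y₃, h₃⟩
  · exact (hadd hS).elim
  rcases hD : (.some x₁ y₁ h₁ : W.toAffine.Point) - .some x₂ y₂ h₂ with _ | ⟨x₄, y₄, h₄⟩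
  · exact (hsub hD).elim
  rw [hS] at hS'
  rw [hD] at hD'
  obtain ⟨hx₁, -, hns₁⟩ := hP
  obtain ⟨hx₂, -, hns₂⟩ := hQ
  obtain ⟨hx₃, -, hns₃⟩ := hS'
  obtain ⟨hx₄, -, hns₄⟩ := hD'
  -- the squared theta relation and the denominator identity
  have hθ' := W.padicSigmaSqEval_theta_of_exists p hex h₁ h₂ hx₁ hx₂
  rw [hS, hD] at hθ'
  simp only [padicParam_some] at hθ'
  have hden' := den_mul_den_eq hden W h₁ h₂ h₃ h₄ hx hS hD
    fun ℓ hℓ => ⟨hns₁ ℓ hℓ, hns₂ ℓ hℓ, hns₃ ℓ hℓ, hns₄ ℓ hℓ⟩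
  have hdenp : ((x₃.den : ℚ) : ℚ_[p]) * ((x₄.den : ℚ) : ℚ_[p]) =
      ((x₁.den : ℚ) : ℚ_[p]) ^ 2 * ((x₂.den : ℚ) : ℚ_[p]) ^ 2 * ((x₁ : ℚ_[p]) - x₂) ^ 2 := by
    have := congrArg (fun q : ℚ => (q : ℚ_[p])) hden'
    push_cast at this ⊢
    exact this
  -- non-vanishing
  have hS₁ := W.padicSigmaSqEval_param_ne_zero p h₁ hx₁
  have hS₂ := W.padicSigmaSqEval_param_ne_zero p h₂ hx₂
  have hS₃ := W.padicSigmaSqEval_param_ne_zero p h₃ hx₃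
  have hS₄ := W.padicSigmaSqEval_param_ne_zero p h₄ hx₄
  have hd : ∀ x : ℚ, ((x.den : ℚ) : ℚ_[p]) ≠ 0 := fun x => by exact_mod_cast x.den_nz
  have hδ : (x₁ : ℚ_[p]) - x₂ ≠ 0 := sub_ne_zero.mpr (by exact_mod_cast hx)
  have hδ' : (x₂ : ℚ_[p]) - x₁ ≠ 0 := by rw [← neg_sub]; exact neg_ne_zero.mpr hδ
  -- logarithms
  have hlogd : padicLog p ((x₃.den : ℚ) : ℚ_[p]) + padicLog p ((x₄.den : ℚ) : ℚ_[p]) =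
      2 * padicLog p ((x₁.den : ℚ) : ℚ_[p]) + 2 * padicLog p ((x₂.den : ℚ) : ℚ_[p]) +
        2 * padicLog p ((x₁ : ℚ_[p]) - x₂) := by
    rw [← hmul (hd x₃) (hd x₄), hdenp, hmul (mul_ne_zero (pow_ne_zero 2 (hd x₁))
      (pow_ne_zero 2 (hd x₂))) (pow_ne_zero 2 hδ), hmul (pow_ne_zero 2 (hd x₁))
      (pow_ne_zero 2 (hd x₂)), padicLog_sq (hd x₁), padicLog_sq (hd x₂), padicLog_sq hδ]
  have hlogS : padicLog p (W.padicSigmaSqEval p (-(x₃ : ℚ_[p]) / y₃)) +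
      padicLog p (W.padicSigmaSqEval p (-(x₄ : ℚ_[p]) / y₄)) =
        2 * padicLog p ((x₁ : ℚ_[p]) - x₂) +
          2 * padicLog p (W.padicSigmaSqEval p (-(x₁ : ℚ_[p]) / y₁)) +
          2 * padicLog p (W.padicSigmaSqEval p (-(x₂ : ℚ_[p]) / y₂)) := by
    rw [← hmul hS₃ hS₄, hθ', hmul (mul_ne_zero (pow_ne_zero 2 hδ') (pow_ne_zero 2 hS₁))
      (pow_ne_zero 2 hS₂), hmul (pow_ne_zero 2 hδ') (pow_ne_zero 2 hS₁), padicLog_sq hS₁,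
      padicLog_sq hS₂, padicLog_sq hδ', ← neg_sub, padicLog_neg hδ]
  rw [hS, hD]
  simp only [canonicalPAdicHeightSq_some]
  linear_combination hlogd - hlogS

end Parallelogram

/-! ### The local-conditions locus is torsion-free, at every prime -/

section Torsion

variable {W : WeierstrassCurve ℚ} [W.IsElliptic] [W.IsIntegral ℤ] {p : ℕ} [Fact p.Prime]

/-- **A rational point with `‖x‖_p > 1` and `z = −x/y` in the sigma disc is non-torsion, for every
prime `p`** (`ℤ`-integral equation). For `p ≥ 3` the disc condition is void and this is
`not_isOfFinAddOrder_of_one_lt_norm` (`E₁(ℚ_p)` is torsion-free, AEC VII.3.4). At `p = 2` the condition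
`‖z‖₂ < 2^{−1/(2−1)} = ½` says `P ∈ Ê(4ℤ₂)`, a subgroup (`some_mem_sigmaDiscSubgroup_iff`,
`formalFiltration 2`); if `P` were torsion, a multiple `R = (x', y')` of it in the same subgroup would
have prime order `q`: for `q` odd this contradicts `val_le_one_of_zsmul_eq_zero` (`ΨSq_q` has the unit
leading coefficient `q²`), and for `q = 2` it says `ψ₂²(x') = 4x'³ + b₂x'² + 2b₄x' + b₆ = 0`, impossible
since `‖x'‖₂ = ‖z'‖₂⁻² > 4` makes `4x'³` the dominant term. This is AEC IV.6.1 (an element of order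
`pⁿ` in `Ê(𝓜)` has `v(z) ≤ v(p)/(pⁿ − pⁿ⁻¹)`) at `p = 2`, `n = 1`: `v(z) ≥ 2 > 1`, together with
IV.3.2(b) (no prime-to-`p` torsion), by division polynomials. [Silverman AEC IV.6.1, IV.3.2(b),
VII.3.4; Exercise 3.7 (method); Stein–Wuthrich 2013, §4 (the disc)] [cite: SilvermanAEC2009, IV.6.1] -/
theorem not_isOfFinAddOrder_of_inSigmaDisc {x y : ℚ} (h : W.toAffine.Nonsingular x y)
    (hx : 1 < ‖(x : ℚ_[p])‖) (hdisc : InSigmaDisc p (-(x : ℚ_[p]) / y)) :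
    ¬ IsOfFinAddOrder (.some x y h : W.toAffine.Point) := by
  by_cases hp2 : p ≠ 2
  · exact not_isOfFinAddOrder_of_one_lt_norm
      (by have := (Fact.out : p.Prime).two_le; omega) h hx
  rw [not_ne_iff] at hp2
  subst hp2
  intro hfin
  haveI : W.IsIntegral (ratAdicValuation 2).integer := W.isIntegral_integer_ratAdicValuation 2
  have hprime : (2 : ℕ).Prime := Fact.out
  -- the point lies in the subgroup `E(ℚ) ∩ Ê(4ℤ₂)`
  have hPmem := (some_mem_sigmaDiscSubgroup_iff (p := 2) h).mpr ⟨hx, hdisc⟩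
  -- a multiple of prime order, still in that subgroup
  set P : W.toAffine.Point := .some x y h with hPdef
  have hN : 0 < addOrderOf P := hfin.addOrderOf_pos
  have hN1 : addOrderOf P ≠ 1 := by
    rw [Ne, AddMonoid.addOrderOf_eq_one_iff]; exact WeierstrassCurve.Affine.Point.some_ne_zero h
  obtain ⟨q, hq, hqN⟩ := Nat.exists_prime_and_dvd hN1
  obtain ⟨m, hm⟩ := hqN
  have hm0 : m ≠ 0 := by rintro rfl; rw [mul_zero] at hm; omega
  have hmlt : m < addOrderOf P := by
    rw [hm]; exact lt_mul_left (Nat.pos_of_ne_zero hm0) hq.one_lt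
  have hRmem := AddSubgroup.nsmul_mem _ hPmem m
  set R := m • P with hRdef
  have hR0 : R ≠ 0 := nsmul_ne_zero_of_lt_addOrderOf hm0 hmlt
  have hqR : q • R = 0 := by
    rw [hRdef, ← mul_nsmul, Nat.mul_comm m q, ← hm]; exact addOrderOf_nsmul_eq_zero P
  rcases hR : R with _ | ⟨x', y', h'⟩
  · exact hR0 hR
  rw [hR] at hRmem hqR
  obtain ⟨hx', hdisc'⟩ := (some_mem_sigmaDiscSubgroup_iff h').mp hRmem
  have hqR' : (q : ℤ) • (.some x' y' h' : W.toAffine.Point) = 0 := by rw [natCast_zsmul]; exact hqR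
  -- the same multiple for the classical `DecidableEq ℚ` instance of the generic files
  have hqR'' := (point_zsmul_irrel (instDecidableEqRat) (fun a b => Classical.propDecidable (a = b))
    (q : ℤ) (.some x' y' h' : W.toAffine.Point)).symm.trans hqR'
  by_cases hq2 : q = 2
  · -- `q = 2`: `ψ₂²(x') = 0`, impossible by dominance of `4x'³`
    subst hq2
    have hΨ : W.Ψ₂Sq.eval x' = 0 := by
      simp only [Nat.cast_ofNat] at hqR''
      have := (W.zsmul_some_eq_zero_iff_eval_ΨSq h' 2).mp hqR''
      rwa [WeierstrassCurve.ΨSq_two] at this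
    -- integrality, degree and leading coefficient of `Ψ₂Sq`
    have hdeg : W.Ψ₂Sq.natDegree ≤ 3 := W.natDegree_Ψ₂Sq_le
    have hlead : W.Ψ₂Sq.coeff 3 = 4 := W.coeff_Ψ₂Sq
    have hcoeff : ∀ i, ratAdicValuation 2 (W.Ψ₂Sq.coeff i) ≤ 1 := fun i => by
      have hmap : W.Ψ₂Sq = ((W.integralModel ℤ).Ψ₂Sq).map (algebraMap ℤ ℚ) := by
        rw [← WeierstrassCurve.map_Ψ₂Sq, ← WeierstrassCurve.baseChange,
          WeierstrassCurve.baseChange_integralModel_eq]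
      rw [hmap, Polynomial.coeff_map, ratAdicValuation_apply, ← NNReal.coe_le_coe, NNReal.coe_one,
        coe_nnnorm, eq_intCast, Rat.cast_intCast]
      exact Padic.norm_int_le_one _
    have hx1 : 1 ≤ ratAdicValuation 2 x' := by
      rw [ratAdicValuation_apply, ← NNReal.coe_le_coe, NNReal.coe_one, coe_nnnorm]; exact hx'.le
    -- `‖x'‖₂ > 4`: `‖z(R)‖ < ½` and `‖z(R)‖² = ‖x'‖⁻¹` (`‖y'‖² = ‖x'‖³`)
    have hx4 : 4 < ‖(x' : ℚ_[2])‖ := by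
      obtain ⟨hsq, hxy⟩ :=
        (W.baseChange ℚ_[2]).norm_sq_eq_norm_cube (nonsingular_ratCast (p := 2) h').1 hx'
      have hx0 : 0 < ‖(x' : ℚ_[2])‖ := one_pos.trans hx'
      have hy0 : 0 < ‖(y' : ℚ_[2])‖ := hx0.trans hxy
      have hz : ‖(x' : ℚ_[2])‖ / ‖(y' : ℚ_[2])‖ < 2⁻¹ := by
        have hd := hdisc'
        unfold InSigmaDisc at hd
        rw [neg_div, norm_neg, norm_div] at hd
        have hrad : ((2 : ℕ) : ℝ) ^ (-(1 / (((2 : ℕ) : ℝ) - 1))) = 2⁻¹ := by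
          rw [show (-(1 / (((2 : ℕ) : ℝ) - 1))) = (-1 : ℝ) by norm_num, Nat.cast_ofNat,
            Real.rpow_neg_one]
        rwa [hrad] at hd
      rw [div_lt_iff₀ hy0] at hz
      have h2 : 2 * ‖(x' : ℚ_[2])‖ < ‖(y' : ℚ_[2])‖ := by linarith
      have h4 : 4 * ‖(x' : ℚ_[2])‖ ^ 2 < ‖(y' : ℚ_[2])‖ ^ 2 := by nlinarith
      rw [hsq] at h4
      nlinarith [pow_pos hx0 2]
    have hdom : 1 < ratAdicValuation 2 (W.Ψ₂Sq.coeff 3) * ratAdicValuation 2 x' := by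
      rw [hlead, ratAdicValuation_apply, ratAdicValuation_apply, ← NNReal.coe_lt_coe, NNReal.coe_one,
        NNReal.coe_mul, coe_nnnorm, coe_nnnorm]
      have h4 : ‖((4 : ℚ) : ℚ_[2])‖ = 4⁻¹ := by
        rw [show ((4 : ℚ) : ℚ_[2]) = ((2 : ℕ) : ℚ_[2]) ^ 2 by norm_num, norm_pow, Padic.norm_p]
        norm_num
      rw [h4, ← div_eq_inv_mul, lt_div_iff₀ (by norm_num : (0 : ℝ) < 4), one_mul]
      exact hx4
    have hval := val_eval_eq_mul_pow hcoeff hdeg hx1 hdom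
    rw [hΨ, map_zero] at hval
    have hc : 0 < ratAdicValuation 2 (W.Ψ₂Sq.coeff 3) := by
      refine pos_of_ne_zero fun h0 => ?_
      rw [h0, zero_mul] at hdom
      exact not_lt_of_ge zero_le_one hdom
    exact (mul_pos hc (pow_pos (zero_lt_one.trans_le hx1) 3)).ne hval
  · -- `q` odd: `ΨSq_q` has unit leading coefficient (`val_le_one_of_zsmul_eq_zero`)
    have hwq : ratAdicValuation 2 ((q : ℤ) : ℚ) = 1 := by
      rw [ratAdicValuation_apply, ← NNReal.coe_eq_one, coe_nnnorm, Int.cast_natCast, Rat.cast_natCast,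
        Padic.norm_natCast_eq_one_iff]
      exact (Nat.coprime_primes hprime hq).mpr (Ne.symm hq2)
    have := Literature.NumberTheory.EllipticCurves.val_le_one_of_zsmul_eq_zero (V := W) hwq hqR''
    rw [ratAdicValuation_apply, ← NNReal.coe_le_coe, NNReal.coe_one, coe_nnnorm] at this
    exact absurd hx' (not_lt.mpr this)

/-- **Admissibility from coordinates, every prime**: a rational point `(x, y)` with `‖x‖_p > 1`,
`−x/y` in the sigma disc and non-singular reduction everywhere is admissible (non-torsion by
`not_isOfFinAddOrder_of_inSigmaDisc`). [Mazur–Stein–Tate 2006, §1; Stein–Wuthrich 2013, §4]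
[cite: MazurSteinTate2006, §1] -/
theorem isAdmissible_of_inSigmaDisc {x y : ℚ} (h : W.toAffine.Nonsingular x y)
    (hx : 1 < ‖(x : ℚ_[p])‖) (hdisc : InSigmaDisc p (-(x : ℚ_[p]) / y))
    (hred : ∀ ℓ : ℕ, ℓ.Prime → W.HasNonsingularReductionAt ℓ x y) :
    W.IsAdmissible p (.some x y h) :=
  ⟨not_isOfFinAddOrder_of_inSigmaDisc h hx hdisc, hx, hdisc, hred⟩

/-- **The local-conditions locus consists of admissible points** (every prime): a point satisfying the
local conditions is non-torsion. [Mazur–Stein–Tate 2006, §1] [cite: MazurSteinTate2006, §1] -/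
theorem isAdmissible_of_satisfiesLocalConditions {P : W.toAffine.Point}
    (hP : W.SatisfiesLocalConditions p P) : W.IsAdmissible p P := by
  rcases P with _ | ⟨x, y, h⟩
  · exact (W.not_satisfiesLocalConditions_zero p hP).elim
  · exact ⟨not_isOfFinAddOrder_of_inSigmaDisc h hP.1 hP.2.1, hP⟩

end Torsion

/-! ### The canonical datum in sigma-squared form: existence and uniqueness -/

section Existence

/-- **Existence of the canonical `p`-adic height datum, sigma-squared form, at every prime with a
sigma-squared pair.** For `W/ℚ` elliptic with `ℤ`-integral equation and a prime `p` at which `W ⊗ ℚ_p`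
carries a sigma-squared pair, there is a symmetric bilinear torsion-vanishing pairing
`E(ℚ) × E(ℚ) → ℚ_p` whose quadratic form on admissible points is the sigma-squared formula
`ĥ^Σ_p(P) = log_p den x(P) − log_p Σ_p(z(P))`: the parallelogram law
(`canonicalPAdicHeightSq_parallelogram_of_exists`) on the torsion-free
(`not_isOfFinAddOrder_of_inSigmaDisc`) subgroup `{O} ∪ {local conditions}`
(`exists_addSubgroup_coe_eq_localConditionsLocus_of_isIntegral`), extended from generic pairs to all
pairs (`parallelogram_of_generic`), and Jordan–von Neumann on a subgroup
(`exists_pairing_of_parallelogram`). [Mazur–Stein–Tate 2006, §1 ("extends uniquely"), §2.6–2.7;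
Stein–Wuthrich 2013, §4.1 eq. (4.1); Silverman 2005, §5 Rem. 2] [cite: MazurSteinTate2006, §2.7] -/
theorem exists_isCanonicalSq_of_exists (W : WeierstrassCurve ℚ) [W.IsElliptic] [W.IsIntegral ℤ]
    (p : ℕ) [Fact p.Prime]
    (hex : ∃ Sq : PowerSeries ℚ_[p], ∃ c : ℚ_[p], (W.baseChange ℚ_[p]).IsMazurTateSigmaSqPair Sq c) :
    ∃ D : PAdicHeightData W p, D.IsCanonicalSq := by
  obtain ⟨H, hH⟩ := W.exists_addSubgroup_coe_eq_localConditionsLocus_of_isIntegral p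
  have hmem : ∀ P, P ∈ H ↔ P = 0 ∨ W.SatisfiesLocalConditions p P := fun P => by
    rw [← SetLike.mem_coe, hH]; rfl
  have hslc : ∀ P ∈ H, P ≠ 0 → W.SatisfiesLocalConditions p P := fun P hP h0 =>
    ((hmem P).mp hP).resolve_left h0
  -- `H` is torsion-free
  have htf' : ∀ P ∈ H, IsOfFinAddOrder P → P = 0 := by
    intro P hP hfin
    by_contra h0
    exact (isAdmissible_of_satisfiesLocalConditions (hslc P hP h0)).1 hfin
  -- the full parallelogram law on `H`
  have hfull := Literature.NumberTheory.EllipticCurves.parallelogram_of_generic H htf'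
    (W.canonicalPAdicHeightSq p) rfl fun P hP Q hQ hP0 hQ0 hPQ hPQ' =>
      canonicalPAdicHeightSq_parallelogram_of_exists hex P Q (hslc P hP hP0) (hslc Q hQ hQ0) hPQ hPQ'
  obtain ⟨B, hsymm, htors, hdiag⟩ :=
    Literature.NumberTheory.EllipticCurves.exists_pairing_of_parallelogram H _ hfull
  exact ⟨⟨B, hsymm, fun P Q hP => htors P Q hP⟩, fun P hP => hdiag P ((hmem P).mpr (Or.inr hP.2))⟩

/-- **Uniqueness of the canonical datum in sigma-squared form**, given admissible multiples: two data
with `IsCanonicalSq` coincide (`PAdicHeightData.ext_of_sq_eq_on`). [Mazur–Stein–Tate 2006, §1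
("extends uniquely … `h_p(nQ) = n²h_p(Q)`")] [folklore] [cite: MazurSteinTate2006, §1] -/
theorem PAdicHeightData.isCanonicalSq_unique {W : WeierstrassCurve ℚ} {p : ℕ} [Fact p.Prime]
    {D₁ D₂ : PAdicHeightData W p}
    (hS : ∀ P : W.toAffine.Point, ¬ IsOfFinAddOrder P → ∃ m : ℕ, m ≠ 0 ∧ W.IsAdmissible p (m • P))
    (h₁ : D₁.IsCanonicalSq) (h₂ : D₂.IsCanonicalSq) : D₁ = D₂ :=
  PAdicHeightData.ext_of_sq_eq_on {P | W.IsAdmissible p P} hS fun Q hQ => by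
    rw [h₁ Q hQ, h₂ Q hQ]

/-- **The canonical datum in sigma-squared form exists uniquely** for `W/ℚ` globally minimal and any
prime `p` at which `W ⊗ ℚ_p` carries a sigma-squared pair (admissible multiples exist,
`exists_admissible_nsmul_holds`). [Mazur–Stein–Tate 2006, §1; Stein–Wuthrich 2013, §4.1 eq. (4.1)]
[cite: MazurSteinTate2006, §2.7] -/
theorem existsUnique_isCanonicalSq_of_exists (W : WeierstrassCurve ℚ) [W.IsElliptic]
    [W.IsGloballyMinimal] (p : ℕ) [Fact p.Prime]
    (hex : ∃ Sq : PowerSeries ℚ_[p], ∃ c : ℚ_[p], (W.baseChange ℚ_[p]).IsMazurTateSigmaSqPair Sq c) :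
    ∃! D : PAdicHeightData W p, D.IsCanonicalSq := by
  obtain ⟨D, hD⟩ := exists_isCanonicalSq_of_exists W p hex
  exact ⟨D, hD, fun D' hD' =>
    PAdicHeightData.isCanonicalSq_unique (exists_admissible_nsmul_holds W p) hD' hD⟩

/-- **At a prime with a genuine Mazur–Tate pair** (every odd good ordinary `p`): the datum exists in the
squared vocabulary too (`(σ, c) ↦ (σ², c)`, `IsMazurTateSigmaPair.sq`); there it IS the `IsCanonical`
datum (`isCanonicalSq_iff_isCanonical_of_exists`). [Mazur–Stein–Tate 2006, Thm. 1.3, §2.7]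
[cite: MazurSteinTate2006, §2.7] -/
theorem exists_isCanonicalSq_of_exists_pair (W : WeierstrassCurve ℚ) [W.IsElliptic] [W.IsIntegral ℤ]
    (p : ℕ) [Fact p.Prime]
    (h : ∃ σ : PowerSeries ℚ_[p], ∃ c : ℚ_[p], (W.baseChange ℚ_[p]).IsMazurTateSigmaPair σ c) :
    ∃ D : PAdicHeightData W p, D.IsCanonicalSq := by
  obtain ⟨σ, c, hσ⟩ := h
  exact exists_isCanonicalSq_of_exists W p ⟨σ ^ 2, c, hσ.sq⟩

/-! ### `p = 2` -/

/-- **THE canonical `2`-adic height datum exists, sigma-squared form.** For `W/ℚ` globally minimal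
with good ORDINARY reduction at `2`, under the printed fact `mazurTate_sigmaSq_existsUnique_two`
(Silverman 2005 §5 Rem. 2: the `2`-adic sigma function exists through its square `σ² ∈ ℤ₂⟦z⟧`, which
supplies the sigma-squared pair of `W ⊗ ℚ₂`, `exists_isMazurTateSigmaSqPair_two`), there is a
symmetric bilinear torsion-vanishing pairing `E(ℚ) × E(ℚ) → ℚ₂` whose quadratic form on admissible
points (non-torsion, `‖x‖₂ > 1`, `‖z‖₂ < ½`, non-singular reduction everywhere) is
`log₂ den x(P) − log₂ Σ₂(z(P))` — i.e. a `D : PAdicHeightData W 2` with `D.IsCanonicalSq`. So the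
`p = 2` statements typed over `IsCanonicalSq` are no longer vacuous. [Mazur–Tate 1991, Thm. 3.1;
Silverman 2005, §5 Rem. 2; Mazur–Stein–Tate 2006, §1, §2.7; Stein–Wuthrich 2013, §4.1 eq. (4.1)]
[cite: Silverman2005DivPoly, §5 Rem. 2] [cite: MazurSteinTate2006, §2.7] -/
theorem exists_isCanonicalSq_two (hMT : mazurTate_sigmaSq_existsUnique_two) (W : WeierstrassCurve ℚ)
    [W.IsElliptic] [W.IsGloballyMinimal] (hgood : W.HasGoodReductionAtPrime 2)
    (hord : ¬ (2 : ℤ) ∣ W.frobeniusTrace 2) : ∃ D : PAdicHeightData W 2, D.IsCanonicalSq :=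
  exists_isCanonicalSq_of_exists W 2 (W.exists_isMazurTateSigmaSqPair_two hMT hgood hord)

/-- **… and it is unique.** [Mazur–Stein–Tate 2006, §1 ("extends uniquely"); Silverman 2005, §5 Rem. 2]
[cite: Silverman2005DivPoly, §5 Rem. 2] [cite: MazurSteinTate2006, §2.7] -/
theorem existsUnique_isCanonicalSq_two (hMT : mazurTate_sigmaSq_existsUnique_two)
    (W : WeierstrassCurve ℚ) [W.IsElliptic] [W.IsGloballyMinimal] (hgood : W.HasGoodReductionAtPrime 2)
    (hord : ¬ (2 : ℤ) ∣ W.frobeniusTrace 2) : ∃! D : PAdicHeightData W 2, D.IsCanonicalSq :=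
  existsUnique_isCanonicalSq_of_exists W 2 (W.exists_isMazurTateSigmaSqPair_two hMT hgood hord)

end Existence

end WeierstrassCurve
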